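/-
Copyright: the b2b-balaban T⁴-continuum CRUX team, row NE7b OWNER lineage `t4-ne7b-p1` (gen 131). Project licence.
-/
import Summits.QuantumFields.BalabanUV.T4Continuum.Spine.NE7b.SupNextHessianEntryBound
import Summits.QuantumFields.BalabanUV.T4Continuum.Spine.NE7b.SupCellGraphDistance

/-!
# THE NEXT HESSIAN HAS VOLUME-UNIFORM EXPONENTIALLY WEIGHTED ROW SUMS IN THE BLOCK METRIC: on the road's small-field step over the cells
# of `S`, with the graph distance `dist = dist_R(p₀, ·)` of the cell graph as the potential ((340)) and `S` in the component of `p₀`: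
#   a NEAR letter `|D²(−log Z_·(S))(ψ₀)(e_y, e_z)| ≤ A₀` for all entries ((341): `A₀ = κ₂ + κ₁²δ₀⁻¹M′ + (κ₁(1+δ₀⁻¹)M′)²`) and a FAR letter
#   `… ≤ C·e^{−η(k+1)∕4}` for cells at distance `2 + k` ((333) with the graph potential: `C = 4(Δ+1)2e^{1+η}ε̃_ΨA_τ^v + M₂ + M₃∕2`) give
#   every entry `≤ (A₀ + C)e^{η∕4}e^{−(η∕4)dist(p₀,p₁)}` (`z ∈ cell p₁`), hence for `Δe^{η′−η∕4} < 1`: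
#   `Σ_{p₁∈S} e^{η′·dist(p₀,p₁)} Σ_{z∈cell p₁} |D²(−log Z_·(S))(ψ₀)(e_y, e_z)| ≤ v(A₀ + C)e^{η∕4} ∕ (1 − Δe^{η′−η∕4})`
# UNIFORMLY IN `#S` — the weighted-row-sum format in which (162) `perturbed_kernel_resolvent_le` consumes non-local kernels
# (row NE7b, node U5c; (333)∕(340)∕(341) BY NAME; [folklore])

Cell `pub-balaban`, sub-cell `t4`, spine estimate NE7b (`T4WeightBudget.RelWeightBound`; the cell's OWN estimate — NOT PRINTED in
[Bałaban 1983–89], NOT PROVED).  Crux-route work under `Spine/NE7b/` by the row OWNER (`t4-ne7b-p1` gen 131, file (342)) under FREEZE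
(0)'s crux-prover clause, on § [NE7bP1-G130-HANDOFF] NEXT (3)(c) («the exponentially weighted ROW SUM `Σ_z|D²W⁺(e_y,e_z)|e^{η′d} < ∞`»);
NOTHING of Bałaban's is named as a Lean object, valued or asserted; no `T4Continuum/Support` leaf typed; no `def`, no notation; zero
`sorry`.  Imports (BY NAME): the OWNER's (341) `…SupNextHessianEntryBound` (`abs_hessian_entry_le`; through it (333)
`abs_hessian_offDiag_le`), (340) `…SupCellGraphDistance` (`dist_le_dist_add_one_of_rel`, `dist_self_zero`, `weighted_sum_le_of_decay`); the
tree's `symm_of_inst`.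

WHAT IS PROVED ([folklore]):
* §1 abstract assemblies `near_bound`, `far_bound`, `abs_sum_le_of_le`; the letter transfers `supSmall_of_cub`, `stable_of_add`;
* §2 THE TWO LETTERS BY NAME: **`near_letter`** ((341) in (333)'s letters: EVERY entry `≤ A₀ = κ₂ + κ₁²δ₀⁻¹M′ + (κ₁(1+δ₀⁻¹)M′)²`),
  **`far_letter`** ((333) with the graph-distance potential: cells at distance `2 + k` have entries `≤ C·e^{−η(k+1)∕4}`, `C` (333)'s letter
  at any `M ≥ M_road`);
* §3 THE ASSEMBLY for abstract letters `A₀, C ≥ 0`: **`entry_decay`** (`|D²(−log Z_·(S))(ψ₀)(e_y)(e_z)| ≤ (A₀ + C)e^{η∕4}e^{−(η∕4)dist(p₀,p₁)}`),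
  `cell_rowsum_le` (`|Σ_{z∈cell p₁}|…|| ≤ v(A₀ + C)e^{η∕4}·e^{−(η∕4)dist(p₀,p₁)}`), THE END **`weighted_rowsum_le`**
  (`Σ_{p₁∈S}(Σ_{z∈cell p₁}|…|)·e^{η′dist(p₀,p₁)} ≤ v(A₀ + C)e^{η∕4}∕(1 − Δe^{η′−η∕4})` for `S` reachable from `p₀`, `Δe^{η′−η∕4} < 1`); §4 toy.

HONEST (what this is NOT).  Locality of the next Hessian as a weighted row-sum letter in the CELL-GRAPH metric, assembled from the two
letters (discharged by name in §2; the assembly keeps them abstract so that the kernel bookkeeping stays light); the identification of the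
cell graph with the torus block metric of (162)∕(163) and the column sums (equal to the row sums by (322) `hessian_symm`) are the
successor's; the letters are O(1) — no smallness without blocking ∕ rescaling (SCOPING-d4); reachability of `S` from `p₀` is a hypothesis (on
the torus the block graph is connected); scalar skeleton ((A3), NC-NE7b-α UNRULED); nothing of Bałaban's asserted.  BY-NAME EFFECT ON THE
WALL: NONE.  NE7b NOT PRINTED ∕ NOT PROVED; spine PROVED 0∕9; rung (B)+1 — the programme's measures remain FINITE-torus statements; NOT the
mass gap, NOT Clay.  HONEST DEPENDENCY: continuum YM on T⁴ ⇐ BetaPertH ∧ nine spine estimates (0∕9 proved); BetaPertH ⇐ (D1) ∧ (D4) ∧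
CAP+tail; G-an2-4 gates asym, D1 and NE2∕3∕4.
-/

set_option autoImplicit false

noncomputable section

namespace Summit.QuantumFields.BalabanUV.T4Continuum.NE7b.SupNextHessianRowSums

open MeasureTheory ProbabilityTheory Finset Real
open scoped BigOperators
open Literature.Analysis.Matrix (HasFiniteRange)
open Literature.Probability.LatticeModels (symm_of_inst)
open SupNextHessianLocality (abs_hessian_offDiag_le)
open SupNextHessianEntryBound (abs_hessian_entry_le)
open SupCellGraphDistance (dist_le_dist_add_one_of_rel dist_self_zero weighted_sum_le_of_decay)

set_option maxSynthPendingDepth 2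

variable {ι : Type} [Fintype ι] [DecidableEq ι] {V : Type*} [DecidableEq V]

/-! ## §1. Abstract assemblies and letter transfers -/

omit [Fintype ι] [DecidableEq ι] in
/-- Near cells: `x ≤ A₀`, `A₀, C, η ≥ 0`, `m ≤ 1` ⟹ `x ≤ (A₀ + C)e^{η∕4}e^{−(η∕4)m}`. [folklore] -/
theorem near_bound {x A₀ C η : ℝ} {m : ℕ} (hx : x ≤ A₀) (hA₀ : 0 ≤ A₀) (hC : 0 ≤ C) (hη : 0 ≤ η) (hm : m ≤ 1) :
    x ≤ (A₀ + C) * exp (η / 4) * exp (-(η / 4 * (m : ℝ))) := by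
  have hm1 : (m : ℝ) ≤ 1 := Nat.cast_le_one.2 hm
  have h1 : (1 : ℝ) ≤ exp (η / 4) * exp (-(η / 4 * (m : ℝ))) := by
    rw [← Real.exp_add]
    exact one_le_exp (by nlinarith [hη, hm1])
  calc x ≤ (A₀ + C) * 1 := by linarith
    _ ≤ (A₀ + C) * (exp (η / 4) * exp (-(η / 4 * (m : ℝ)))) := mul_le_mul_of_nonneg_left h1 (add_nonneg hA₀ hC)
    _ = (A₀ + C) * exp (η / 4) * exp (-(η / 4 * (m : ℝ))) := by ring

omit [Fintype ι] [DecidableEq ι] in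
/-- Far cells: `x ≤ C·e^{−η(k+1)∕4}`, `A₀ ≥ 0`, `m = 2 + k` ⟹ `x ≤ (A₀ + C)e^{η∕4}e^{−(η∕4)m}`. [folklore] -/
theorem far_bound {x A₀ C η : ℝ} {m k : ℕ} (hx : x ≤ C * exp (-(η * ((k : ℝ) + 1)) / 4)) (hA₀ : 0 ≤ A₀) (hk : m = 2 + k) :
    x ≤ (A₀ + C) * exp (η / 4) * exp (-(η / 4 * (m : ℝ))) := by
  have e : exp (-(η * ((k : ℝ) + 1)) / 4) = exp (η / 4) * exp (-(η / 4 * (m : ℝ))) := by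
    rw [← Real.exp_add, hk]
    push_cast
    congr 1
    ring
  rw [e] at hx
  have hE : 0 ≤ exp (η / 4) * exp (-(η / 4 * (m : ℝ))) := by positivity
  calc x ≤ C * (exp (η / 4) * exp (-(η / 4 * (m : ℝ)))) := hx
    _ ≤ (A₀ + C) * (exp (η / 4) * exp (-(η / 4 * (m : ℝ)))) := mul_le_mul_of_nonneg_right (by linarith) hE
    _ = (A₀ + C) * exp (η / 4) * exp (-(η / 4 * (m : ℝ))) := by ring

omit [Fintype ι] [DecidableEq ι] in
/-- A sum of `≤ v` terms each in `[0, B₁·E]` (`B₁, E ≥ 0`) is `≤ (v·B₁)·E` in absolute value. [folklore] -/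
theorem abs_sum_le_of_le {T : Finset ι} {f : ι → ℝ} {B₁ E : ℝ} {v : ℕ} (hf0 : ∀ z ∈ T, 0 ≤ f z) (hB : ∀ z ∈ T, f z ≤ B₁ * E)
    (hB₁ : 0 ≤ B₁) (hE : 0 ≤ E) (hv : T.card ≤ v) : |∑ z ∈ T, f z| ≤ ((v : ℝ) * B₁) * E := by
  rw [abs_of_nonneg (sum_nonneg hf0)]
  calc ∑ z ∈ T, f z ≤ ∑ _z ∈ T, B₁ * E := sum_le_sum hB
    _ = (T.card : ℝ) * (B₁ * E) := by rw [sum_const, nsmul_eq_mul]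
    _ ≤ (v : ℝ) * (B₁ * E) := mul_le_mul_of_nonneg_right (by exact_mod_cast hv) (mul_nonneg hB₁ hE)
    _ = ((v : ℝ) * B₁) * E := by ring

omit [Fintype ι] [DecidableEq ι] in
/-- The cubic letter on `|u| ≤ h` gives the sup letter `|w| ≤ c₃h³ + 2c₂h²` there (`c₂, c₃ ≥ 0`). [folklore] -/
theorem supSmall_of_cub {w : ι → ℝ → ℝ} {c₂ c₃ h : ℝ} (hc₂ : 0 ≤ c₂) (hc₃ : 0 ≤ c₃)
    (hcub : ∀ x, ∀ u : ℝ, |u| ≤ h → |w x u| ≤ c₃ * |u| ^ 3) : ∀ x, ∀ u : ℝ, |u| ≤ h → |w x u| ≤ c₃ * h ^ 3 + 2 * c₂ * h ^ 2 := by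
  intro x u hu
  have h1 := hcub x u hu
  have h2 : |u| ^ 3 ≤ h ^ 3 := pow_le_pow_left₀ (abs_nonneg u) hu 3
  nlinarith [mul_nonneg hc₂ (sq_nonneg h)]

omit [Fintype ι] [DecidableEq ι] in
/-- Stability with `κ₀` gives stability with `κ₀ + 2c₂` (`c₂ ≥ 0`). [folklore] -/
theorem stable_of_add {w : ι → ℝ → ℝ} {κ₀ c₂ : ℝ} (hc₂ : 0 ≤ c₂) (hstab : ∀ x, ∀ u : ℝ, -(κ₀ * u ^ 2) ≤ w x u) :
    ∀ x, ∀ u : ℝ, -((κ₀ + 2 * c₂) * u ^ 2) ≤ w x u := fun x u => by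
  nlinarith [hstab x u, mul_nonneg hc₂ (sq_nonneg u)]

section Main

variable {Γ : Matrix ι ι ℝ} {γop γ : ℝ} {dι : ι → ι → ℕ} {ρ : ℕ} {cell : V → Finset ι} {v : ℕ} {R : V → V → Prop}
  [DecidableRel R] [Std.Symm R] {nbr : V → Finset V} {Δ : ℕ} {w w' w'' : ι → ℝ → ℝ} {κ₀ κ₁ κ₂ c₂ c₃ h κ τ θ Ψ δ₀ η : ℝ}

/-! ## §2. The two letters by name -/

/-- **THE NEAR LETTER** ((341) in (333)'s letters: stability `κ₀` ⟹ `κ₀ + 2c₂`, the cubic letter ⟹ the sup letter `c₃h³ + 2c₂h²`): for ALL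
`p₁ ∈ S`, `z ∈ cell p₁`: `|D²(−log Z_·(S))(ψ₀)(e_y)(e_z)| ≤ κ₂ + κ₁²δ₀⁻¹M′ + (κ₁(1+δ₀⁻¹)M′)²`. [folklore] -/
theorem near_letter (hΓ : Γ.PosSemidef) (hΓop : (γop • (1 : Matrix ι ι ℝ) - Γ).PosSemidef) (hdiag : ∀ i, Γ i i ≤ γ) (hγ : 0 ≤ γ)
    (hfr : HasFiniteRange dι ρ Γ) (hdisj : ∀ p q, p ≠ q → Disjoint (cell p) (cell q)) (hv : ∀ p, (cell p).card ≤ v)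
    (hR : ∀ (p p' : V) (x y : ι), x ∈ cell p → y ∈ cell p' → dι x y ≤ ρ → p = p' ∨ R p p') (hΔ : ∀ x, (nbr x).card ≤ Δ)
    (hnbr : ∀ x y, R x y → y ∈ nbr x) (hw' : ∀ x t, HasDerivAt (w x) (w' x t) t) (hw'' : ∀ x t, HasDerivAt (w' x) (w'' x t) t)
    (hw'm : ∀ x, Measurable (w' x)) (hw''m : ∀ x, Measurable (w'' x)) (hκ₀ : 0 ≤ κ₀) (hκ₁ : 0 ≤ κ₁) (hc₂ : 0 ≤ c₂) (hc₃ : 0 ≤ c₃) (hh : 0 ≤ h)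
    (hδ₀ : 0 < δ₀) (hstab : ∀ x, ∀ u : ℝ, -(κ₀ * u ^ 2) ≤ w x u) (hcub : ∀ x, ∀ u : ℝ, |u| ≤ h → |w x u| ≤ c₃ * |u| ^ 3)
    (hw'b : ∀ x u, |w' x u| ≤ κ₁ * |u|) (hw''b : ∀ x u, |w'' x u| ≤ κ₂) (hκ : 2 * ((κ₀ + 2 * c₂) + δ₀) ≤ κ)
    (hτ : 0 < τ) (hθ0 : 0 < θ) (hθ1 : θ < 1) (hκθ : κ * (1 + τ) * γop ≤ θ) (S : Finset V)
    (ψ₀ : EuclideanSpace ℝ ι) (hψ : ∀ p ∈ S, ∑ x ∈ cell p, ψ₀ x ^ 2 ≤ Ψ ^ 2) {p₀ : V} (hp₀ : p₀ ∈ S) {y : ι} (hy : y ∈ cell p₀)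
    (hsmall : Real.exp 1 * (((max (exp (v * ((c₃ * h ^ 3 + 2 * c₂ * h ^ 2) + δ₀ * h ^ 2)) - 1)
      (2 * exp (-((κ / 2 - ((κ₀ + 2 * c₂) + δ₀)) * h ^ 2)))) * exp (κ * (1 + τ⁻¹) * Ψ ^ 2 / 2)) *
      ((1 - θ) ^ (-(κ * (1 + τ) * γ / (2 * θ)))) ^ v) * ((Δ : ℝ) + 1) ^ 2 ≤ 1 / 2) :
    ∀ p₁ ∈ S, ∀ z ∈ cell p₁,
      |(fderiv ℝ (fun ψ : EuclideanSpace ℝ ι => fderiv ℝ (fun φ : EuclideanSpace ℝ ι =>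
        -log (∫ ω : EuclideanSpace ℝ ι, exp (-(∑ p ∈ S, ∑ x ∈ cell p, w x (ω x + φ x))) ∂(multivariateGaussian 0 Γ))) ψ) ψ₀
        (EuclideanSpace.single y (1 : ℝ))) (EuclideanSpace.single z (1 : ℝ))| ≤
        κ₂ + κ₁ ^ 2 * (δ₀⁻¹ * exp (2 * ((1 : ℝ) * ((Δ : ℝ) + 1) * (2 * (Real.exp 1 * (((max (exp (v * ((c₃ * h ^ 3 + 2 * c₂ * h ^ 2) + δ₀ * h ^ 2)) - 1) (2 * exp (-((κ / 2 - ((κ₀ + 2 * c₂) + δ₀)) * h ^ 2)))) * exp (κ * (1 + τ⁻¹) * Ψ ^ 2 / 2)) *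
          ((1 - θ) ^ (-(κ * (1 + τ) * γ / (2 * θ)))) ^ v)))))) +
        (κ₁ * ((1 + δ₀⁻¹) * exp (2 * ((1 : ℝ) * ((Δ : ℝ) + 1) * (2 * (Real.exp 1 * (((max (exp (v * ((c₃ * h ^ 3 + 2 * c₂ * h ^ 2) + δ₀ * h ^ 2)) - 1) (2 * exp (-((κ / 2 - ((κ₀ + 2 * c₂) + δ₀)) * h ^ 2)))) * exp (κ * (1 + τ⁻¹) * Ψ ^ 2 / 2)) *
          ((1 - θ) ^ (-(κ * (1 + τ) * γ / (2 * θ)))) ^ v))))))) ^ 2 := fun p₁ hp₁ z hz =>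
  abs_hessian_entry_le (κ₀ := κ₀ + 2 * c₂) hΓ hΓop hdiag hγ hfr hdisj hv hR hΔ hnbr hw' hw'' hw'm hw''m (by positivity) hκ₁ hδ₀
    (by positivity : (0 : ℝ) ≤ c₃ * h ^ 3 + 2 * c₂ * h ^ 2) hh (stable_of_add hc₂ hstab) (supSmall_of_cub hc₂ hc₃ hcub) hw'b hw''b hκ
    hτ hθ0 hθ1 hκθ S ψ₀ hψ hp₀ hp₁ hy hz hsmall

/-- **THE FAR LETTER** ((333) with the graph-distance potential of (340), `n = k` for cells at distance `2 + k`): for `p₁ ∈ S` with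
`dist(p₀,p₁) = 2 + k` and `z ∈ cell p₁`: `|D²(−log Z_·(S))(ψ₀)(e_y)(e_z)| ≤ C·e^{−η(k+1)∕4}`. [folklore] -/
theorem far_letter (hΓ : Γ.PosSemidef) (hΓop : (γop • (1 : Matrix ι ι ℝ) - Γ).PosSemidef) (hdiag : ∀ i, Γ i i ≤ γ) (hγ : 0 ≤ γ)
    (hfr : HasFiniteRange dι ρ Γ) (hdisj : ∀ p q, p ≠ q → Disjoint (cell p) (cell q)) (hv : ∀ p, (cell p).card ≤ v)
    (hR : ∀ (p p' : V) (x y : ι), x ∈ cell p → y ∈ cell p' → dι x y ≤ ρ → p = p' ∨ R p p') (hΔ : ∀ x, (nbr x).card ≤ Δ)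
    (hnbr : ∀ x y, R x y → y ∈ nbr x) (hw' : ∀ x t, HasDerivAt (w x) (w' x t) t) (hw'' : ∀ x t, HasDerivAt (w' x) (w'' x t) t)
    (hw'm : ∀ x, Measurable (w' x)) (hw''m : ∀ x, Measurable (w'' x)) (hκ₀ : 0 ≤ κ₀) (hκ₁ : 0 ≤ κ₁) (hc₂ : 0 ≤ c₂) (hc₃ : 0 ≤ c₃) (hh : 0 ≤ h)
    (hδ₀ : 0 < δ₀) (hstab : ∀ x, ∀ u : ℝ, -(κ₀ * u ^ 2) ≤ w x u) (hcub : ∀ x, ∀ u : ℝ, |u| ≤ h → |w x u| ≤ c₃ * |u| ^ 3)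
    (hw'b : ∀ x u, |w' x u| ≤ κ₁ * |u|) (hw'q : ∀ x u, |w' x u| ≤ c₂ * u ^ 2) (hw''b : ∀ x u, |w'' x u| ≤ κ₂) (hκ : 2 * ((κ₀ + 2 * c₂) + δ₀) ≤ κ)
    (hτ : 0 < τ) (hθ0 : 0 < θ) (hθ1 : θ < 1) (hκθ : κ * (1 + τ) * γop ≤ θ) (hκθ₈ : 2 * (κ₀ + 2 * (4 * c₂)) * (1 + τ) * γop ≤ θ) (S : Finset V)
    (ψ₀ : EuclideanSpace ℝ ι) (hψ : ∀ p ∈ S, ∑ x ∈ cell p, ψ₀ x ^ 2 ≤ Ψ ^ 2) {p₀ : V} (hp₀ : p₀ ∈ S) {y : ι} (hy : y ∈ cell p₀) (hη : 0 ≤ η)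
    (hsmall₂ : Real.exp (1 + η) * (((max (exp (v * (c₃ * h ^ 3 + 2 * c₂ * h ^ 2)) - 1) (2 * exp (-((κ / 2 - (κ₀ + 2 * c₂)) * h ^ 2)))) *
      exp (κ * (1 + τ⁻¹) * Ψ ^ 2 / 2)) * ((1 - θ) ^ (-(κ * (1 + τ) * γ / (2 * θ)))) ^ v) * ((Δ : ℝ) + 1) ^ 2 ≤ 1 / 2)
    (hsmall : Real.exp 1 * (((max (exp (v * ((c₃ * h ^ 3 + 2 * c₂ * h ^ 2) + δ₀ * h ^ 2)) - 1)
      (2 * exp (-((κ / 2 - ((κ₀ + 2 * c₂) + δ₀)) * h ^ 2)))) * exp (κ * (1 + τ⁻¹) * Ψ ^ 2 / 2)) *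
      ((1 - θ) ^ (-(κ * (1 + τ) * γ / (2 * θ)))) ^ v) * ((Δ : ℝ) + 1) ^ 2 ≤ 1 / 2) {M : ℝ}
    (hM : exp (2 * ((1 : ℝ) * ((Δ : ℝ) + 1) * (2 * (Real.exp 1 *
        (((max (exp (v * ((c₃ * h ^ 3 + 2 * c₂ * h ^ 2) + δ₀ * h ^ 2)) - 1) (2 * exp (-((κ / 2 - ((κ₀ + 2 * c₂) + δ₀)) * h ^ 2)))) *
          exp (κ * (1 + τ⁻¹) * Ψ ^ 2 / 2)) * ((1 - θ) ^ (-(κ * (1 + τ) * γ / (2 * θ)))) ^ v))))) ≤ M) :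
    ∀ p₁ ∈ S, ∀ z ∈ cell p₁, ∀ k : ℕ, (SimpleGraph.fromRel R).dist p₀ p₁ = 2 + k →
      |(fderiv ℝ (fun ψ : EuclideanSpace ℝ ι => fderiv ℝ (fun φ : EuclideanSpace ℝ ι =>
        -log (∫ ω : EuclideanSpace ℝ ι, exp (-(∑ p ∈ S, ∑ x ∈ cell p, w x (ω x + φ x))) ∂(multivariateGaussian 0 Γ))) ψ) ψ₀
        (EuclideanSpace.single y (1 : ℝ))) (EuclideanSpace.single z (1 : ℝ))| ≤
        (4 * ((1 : ℝ) * ((Δ : ℝ) + 1) * (2 * (Real.exp (1 + η) *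
        (((max (exp (v * (c₃ * h ^ 3 + 2 * c₂ * h ^ 2)) - 1) (2 * exp (-((κ / 2 - (κ₀ + 2 * c₂)) * h ^ 2)))) * exp (κ * (1 + τ⁻¹) * Ψ ^ 2 / 2)) * ((1 - θ) ^ (-(κ * (1 + τ) * γ / (2 * θ)))) ^ v)))) +
        ((2 * c₂ ^ 2 * (δ₀ ^ 2)⁻¹ * M) + (c₂ * δ₀⁻¹ * M) ^ 2) + ((6 * c₂ ^ 3 * (δ₀ ^ 3)⁻¹ * M) + (c₂ * δ₀⁻¹ * M) * (2 * c₂ ^ 2 * (δ₀ ^ 2)⁻¹ * M) +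
        2 * (2 * c₂ ^ 2 * (δ₀ ^ 2)⁻¹ * M) * (c₂ * δ₀⁻¹ * M) + 2 * (c₂ * δ₀⁻¹ * M) * (c₂ * δ₀⁻¹ * M) ^ 2) / 2) * exp (-(η * ((k : ℝ) + 1)) / 4) :=
  fun p₁ hp₁ z hz k hk =>
  abs_hessian_offDiag_le hΓ hΓop hdiag hγ hfr hdisj hv hR hΔ hnbr hw' hw'' hw'm hw''m hκ₀ hκ₁ hc₂ hc₃ hh hδ₀ hstab hcub
    hw'b hw'q hw''b hκ hτ hθ0 hθ1 hκθ hκθ₈ S ψ₀ hψ hp₀ hp₁ hy hz (d := fun q => (SimpleGraph.fromRel R).dist p₀ q)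
    (fun p q hpq => dist_le_dist_add_one_of_rel p₀ hpq) (n := k) (dist_self_zero p₀)
    (by show k + 2 ≤ (SimpleGraph.fromRel R).dist p₀ p₁; omega) hη hsmall₂ hsmall hM

/-! ## §3. The assembly for abstract letters -/

omit [DecidableEq V] [DecidableRel R] [Std.Symm R] in
/-- **EVERY ENTRY DECAYS IN THE GRAPH DISTANCE** (abstract near∕far letters `A₀, C ≥ 0`): for `p₁ ∈ S`, `z ∈ cell p₁`,
`|D²(−log Z_·(S))(ψ₀)(e_y)(e_z)| ≤ (A₀ + C)e^{η∕4}e^{−(η∕4)dist(p₀,p₁)}`. [folklore] -/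
theorem entry_decay (S : Finset V) (ψ₀ : EuclideanSpace ℝ ι) (p₀ : V) (y : ι) {A₀ C η : ℝ} (hA₀ : 0 ≤ A₀) (hC : 0 ≤ C)
    (hη : 0 ≤ η)
    (hnear : ∀ p₁ ∈ S, ∀ z ∈ cell p₁,
      |(fderiv ℝ (fun ψ : EuclideanSpace ℝ ι => fderiv ℝ (fun φ : EuclideanSpace ℝ ι =>
        -log (∫ ω : EuclideanSpace ℝ ι, exp (-(∑ p ∈ S, ∑ x ∈ cell p, w x (ω x + φ x))) ∂(multivariateGaussian 0 Γ))) ψ) ψ₀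
        (EuclideanSpace.single y (1 : ℝ))) (EuclideanSpace.single z (1 : ℝ))| ≤ A₀)
    (hfar : ∀ p₁ ∈ S, ∀ z ∈ cell p₁, ∀ k : ℕ, (SimpleGraph.fromRel R).dist p₀ p₁ = 2 + k →
      |(fderiv ℝ (fun ψ : EuclideanSpace ℝ ι => fderiv ℝ (fun φ : EuclideanSpace ℝ ι =>
        -log (∫ ω : EuclideanSpace ℝ ι, exp (-(∑ p ∈ S, ∑ x ∈ cell p, w x (ω x + φ x))) ∂(multivariateGaussian 0 Γ))) ψ) ψ₀
        (EuclideanSpace.single y (1 : ℝ))) (EuclideanSpace.single z (1 : ℝ))| ≤ C * exp (-(η * ((k : ℝ) + 1)) / 4)) :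
    ∀ p₁ ∈ S, ∀ z ∈ cell p₁,
      |(fderiv ℝ (fun ψ : EuclideanSpace ℝ ι => fderiv ℝ (fun φ : EuclideanSpace ℝ ι =>
        -log (∫ ω : EuclideanSpace ℝ ι, exp (-(∑ p ∈ S, ∑ x ∈ cell p, w x (ω x + φ x))) ∂(multivariateGaussian 0 Γ))) ψ) ψ₀
        (EuclideanSpace.single y (1 : ℝ))) (EuclideanSpace.single z (1 : ℝ))| ≤
        (A₀ + C) * exp (η / 4) * exp (-(η / 4 * ((SimpleGraph.fromRel R).dist p₀ p₁ : ℝ))) := by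
  intro p₁ hp₁ z hz
  rcases Nat.lt_or_ge ((SimpleGraph.fromRel R).dist p₀ p₁) 2 with hlt | hge
  · exact near_bound (hnear p₁ hp₁ z hz) hA₀ hC hη (by omega)
  · obtain ⟨k, hk⟩ := Nat.exists_eq_add_of_le hge
    exact far_bound (hfar p₁ hp₁ z hz k hk) hA₀ hk

omit [DecidableEq V] [DecidableRel R] [Std.Symm R] in
/-- **The row sum over one cell**: `|Σ_{z∈cell p₁}|D²(−log Z_·(S))(ψ₀)(e_y)(e_z)|| ≤ (v(A₀ + C)e^{η∕4})·e^{−(η∕4)dist(p₀,p₁)}`. [folklore] -/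
theorem cell_rowsum_le (hv : ∀ p, (cell p).card ≤ v) (S : Finset V) (ψ₀ : EuclideanSpace ℝ ι) (p₀ : V) (y : ι) {A₀ C η : ℝ} (hA₀ : 0 ≤ A₀) (hC : 0 ≤ C)
    (hη : 0 ≤ η)
    (hnear : ∀ p₁ ∈ S, ∀ z ∈ cell p₁,
      |(fderiv ℝ (fun ψ : EuclideanSpace ℝ ι => fderiv ℝ (fun φ : EuclideanSpace ℝ ι =>
        -log (∫ ω : EuclideanSpace ℝ ι, exp (-(∑ p ∈ S, ∑ x ∈ cell p, w x (ω x + φ x))) ∂(multivariateGaussian 0 Γ))) ψ) ψ₀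
        (EuclideanSpace.single y (1 : ℝ))) (EuclideanSpace.single z (1 : ℝ))| ≤ A₀)
    (hfar : ∀ p₁ ∈ S, ∀ z ∈ cell p₁, ∀ k : ℕ, (SimpleGraph.fromRel R).dist p₀ p₁ = 2 + k →
      |(fderiv ℝ (fun ψ : EuclideanSpace ℝ ι => fderiv ℝ (fun φ : EuclideanSpace ℝ ι =>
        -log (∫ ω : EuclideanSpace ℝ ι, exp (-(∑ p ∈ S, ∑ x ∈ cell p, w x (ω x + φ x))) ∂(multivariateGaussian 0 Γ))) ψ) ψ₀
        (EuclideanSpace.single y (1 : ℝ))) (EuclideanSpace.single z (1 : ℝ))| ≤ C * exp (-(η * ((k : ℝ) + 1)) / 4)) :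
    ∀ p₁ ∈ S,
      |(∑ z ∈ cell p₁, |(fderiv ℝ (fun ψ : EuclideanSpace ℝ ι => fderiv ℝ (fun φ : EuclideanSpace ℝ ι =>
        -log (∫ ω : EuclideanSpace ℝ ι, exp (-(∑ p ∈ S, ∑ x ∈ cell p, w x (ω x + φ x))) ∂(multivariateGaussian 0 Γ))) ψ) ψ₀
        (EuclideanSpace.single y (1 : ℝ))) (EuclideanSpace.single z (1 : ℝ))|)| ≤
        ((v : ℝ) * ((A₀ + C) * exp (η / 4))) * exp (-(η / 4 * ((SimpleGraph.fromRel R).dist p₀ p₁ : ℝ))) := fun p₁ hp₁ =>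
  abs_sum_le_of_le (fun z _ => abs_nonneg _) (entry_decay S ψ₀ p₀ y hA₀ hC hη hnear hfar p₁ hp₁) (by positivity) (exp_pos _).le (hv p₁)

omit [DecidableRel R] in
/-- **THE END — THE NEXT HESSIAN HAS VOLUME-UNIFORM EXPONENTIALLY WEIGHTED ROW SUMS** (abstract near∕far letters `A₀, C ≥ 0`, discharged by
`near_letter` ∕ `far_letter`): `R` symmetric with `≤ Δ` neighbours, `S` reachable from `p₀` in the cell graph, `Δe^{η′−η∕4} < 1` ⟹
`Σ_{p₁∈S}(Σ_{z∈cell p₁}|D²(−log Z_·(S))(ψ₀)(e_y)(e_z)|)·e^{η′·dist(p₀,p₁)} ≤ v(A₀ + C)e^{η∕4}∕(1 − Δe^{η′−η∕4})`, uniformly in `#S`. [folklore] -/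
theorem weighted_rowsum_le (hv : ∀ p, (cell p).card ≤ v) (hΔ : ∀ x, (nbr x).card ≤ Δ) (hnbr : ∀ x y, R x y → y ∈ nbr x)
    (S : Finset V) (ψ₀ : EuclideanSpace ℝ ι) (p₀ : V) (y : ι) {A₀ C η : ℝ} (hA₀ : 0 ≤ A₀) (hC : 0 ≤ C)
    (hη : 0 ≤ η)
    (hnear : ∀ p₁ ∈ S, ∀ z ∈ cell p₁,
      |(fderiv ℝ (fun ψ : EuclideanSpace ℝ ι => fderiv ℝ (fun φ : EuclideanSpace ℝ ι =>
        -log (∫ ω : EuclideanSpace ℝ ι, exp (-(∑ p ∈ S, ∑ x ∈ cell p, w x (ω x + φ x))) ∂(multivariateGaussian 0 Γ))) ψ) ψ₀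
        (EuclideanSpace.single y (1 : ℝ))) (EuclideanSpace.single z (1 : ℝ))| ≤ A₀)
    (hfar : ∀ p₁ ∈ S, ∀ z ∈ cell p₁, ∀ k : ℕ, (SimpleGraph.fromRel R).dist p₀ p₁ = 2 + k →
      |(fderiv ℝ (fun ψ : EuclideanSpace ℝ ι => fderiv ℝ (fun φ : EuclideanSpace ℝ ι =>
        -log (∫ ω : EuclideanSpace ℝ ι, exp (-(∑ p ∈ S, ∑ x ∈ cell p, w x (ω x + φ x))) ∂(multivariateGaussian 0 Γ))) ψ) ψ₀
        (EuclideanSpace.single y (1 : ℝ))) (EuclideanSpace.single z (1 : ℝ))| ≤ C * exp (-(η * ((k : ℝ) + 1)) / 4))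
    (hS : ∀ p ∈ S, (SimpleGraph.fromRel R).Reachable p₀ p) {η' : ℝ} (hq : (Δ : ℝ) * exp (η' - η / 4) < 1) :
    ∑ p₁ ∈ S, (∑ z ∈ cell p₁, |(fderiv ℝ (fun ψ : EuclideanSpace ℝ ι => fderiv ℝ (fun φ : EuclideanSpace ℝ ι =>
        -log (∫ ω : EuclideanSpace ℝ ι, exp (-(∑ p ∈ S, ∑ x ∈ cell p, w x (ω x + φ x))) ∂(multivariateGaussian 0 Γ))) ψ) ψ₀
        (EuclideanSpace.single y (1 : ℝ))) (EuclideanSpace.single z (1 : ℝ))|) * exp (η' * (SimpleGraph.fromRel R).dist p₀ p₁) ≤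
      ((v : ℝ) * ((A₀ + C) * exp (η / 4))) / (1 - (Δ : ℝ) * exp (η' - η / 4)) := by
  have h := weighted_sum_le_of_decay symm_of_inst hΔ hnbr p₀ S hS
    (a := fun q => ∑ z ∈ cell q, |(fderiv ℝ (fun ψ : EuclideanSpace ℝ ι => fderiv ℝ (fun φ : EuclideanSpace ℝ ι =>
        -log (∫ ω : EuclideanSpace ℝ ι, exp (-(∑ p ∈ S, ∑ x ∈ cell p, w x (ω x + φ x))) ∂(multivariateGaussian 0 Γ))) ψ) ψ₀
        (EuclideanSpace.single y (1 : ℝ))) (EuclideanSpace.single z (1 : ℝ))|)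
    (c := η / 4) (η' := η') (by positivity) (cell_rowsum_le hv S ψ₀ p₀ y hA₀ hC hη hnear hfar) hq
  refine le_of_eq_of_le (sum_congr rfl fun q _ => ?_) h
  rw [abs_of_nonneg (sum_nonneg fun z _ => abs_nonneg _)]

end Main

/-! ## §4. Toy -/

/-- Toy (§1): the ZERO remainder is stable with `0 + 2c₂` for `c₂ ≥ 0`. -/
example (c₂ : ℝ) (hc₂ : 0 ≤ c₂) : ∀ x : Fin 2, ∀ u : ℝ, -((0 + 2 * c₂) * u ^ 2) ≤ (fun (_ : Fin 2) (_ : ℝ) => (0 : ℝ)) x u :=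
  stable_of_add hc₂ (fun _ u => by simp)

end Summit.QuantumFields.BalabanUV.T4Continuum.NE7b.SupNextHessianRowSums
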